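import Mathlib.NumberTheory.Padics.RingHoms
import Literature.NumberTheory.EllipticCurves.TwoIsogenySelmerGroup
import Literature.NumberTheory.EllipticCurves.BinaryQuarticLocalSolubility
import Literature.NumberTheory.EllipticCurves.BinaryQuarticBadReductionSolubilityProofs
import HarnessLib

/-!
# Route IsogenyRedei, crux `PencilSelmerDictionary` (stmt-Parity-11584), line
# `toric-node-vacuity-cassels`: odd places impose no condition on the descent on the divisors of
# `b = t² + 1`

For the pencil `E_t : y² = x³ + 2t·x² + (t² + 1)·x` (`t ≥ 1`) and its `2`-isogeny with kernel
`(0, 0)`, the homogeneous spaces of the descent on the divisors of `b = t² + 1` are the curves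
`w² = q(u, z) = d u⁴ + 2t u²z² + e z⁴` with `d e = t² + 1`
(`Literature.NumberTheory.EllipticCurves.twoIsogenyQuartic (2t) d e = ⟨d, 0, 2t, 0, e⟩`,
Silverman, *AEC* X.4.9). We prove (`stub_bSideOddPlaces`) that for every squarefree `d > 0`
dividing `t² + 1` and EVERY odd prime `p` this curve has a `ℚ_p`-point:

* `p ∤ t² + 1`, `p ≥ 5`: the discriminant is `Δ = 16 d e ((2t)² − 4de)² = 256 (t² + 1)`, a
  `p`-adic unit, so good reduction gives a point
  (`BinaryQuartic.isSoluble_padic_of_not_dvd_disc`, Bhargava–Shankar Prop. 3.18);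
* `p = 3`: a unit square value of `q(x, 1)` or `q(1, x)` modulo `3` exists (finite check over
  `ZMod 3` under `d e = t² + 1`), and lifts by Hensel's lemma;
* `p ∣ t² + 1`: in `𝔽_p` we have `τ² = −1` (`τ = t mod p`), `2τ = (τ + 1)²`, and `d ≡ 0` or
  `e ≡ 0`; then `q(x, 1) = ((τ+1)x)² + e` (resp. `q(1, s) = d + ((τ+1)s)²`) takes the unit square
  value `((e+1)/2)²` at `x = (e−1)/(2(τ+1))` (resp. the symmetric point), or the value `τ² = e`
  at `x = 0` in the degenerate case `e ≡ −1`; Hensel lifts the smooth point.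

Everything is proved; no definitions, no named facts. The small generic tools (evaluation and
discriminant of the quartic, Hensel at odd `p` through both charts, `τ² = −1`) are private copies
of the line's shared tools file.

## References

* J. H. Silverman, *The Arithmetic of Elliptic Curves*, 2nd ed., GTM 106 (2009), Prop. X.4.9.
* M. Bhargava, A. Shankar, Ann. of Math. (2) 181 (2015) 191–242, Prop. 3.18 (good reduction at
  `p ≥ 5` with `p ∤ Δ` implies `ℚ_p`-solubility).
-/

noncomputable section

open scoped Classical

namespace Summit.Parity.BatemanHorn.Theorems.PencilSelmerDictionary

open Literature.NumberTheory.EllipticCurves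
open Literature.NumberTheory.EllipticCurves.BinaryQuartic

/-! ## Private copies of the shared tools -/

/-- The discriminant of `⟨d, 0, a, 0, d'⟩` is `16 d d' (a² − 4 d d')²`. [folklore] -/
private theorem disc_twoIsogenyQuartic (a d d' : ℤ) :
    (twoIsogenyQuartic a d d').disc = 16 * d * d' * (a ^ 2 - 4 * d * d') ^ 2 := by
  simp only [twoIsogenyQuartic, BinaryQuartic.disc]
  ring

/-- Functoriality of `map` on integral forms: mapping along `ℤ → R → S` is mapping along `ℤ → S`.
[folklore] -/
private theorem map_map_intCast {R S : Type*} [CommRing R] [CommRing S] (f : BinaryQuartic ℤ)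
    (g : R →+* S) : (f.map (Int.castRingHom R)).map g = f.map (Int.castRingHom S) := by
  ext <;> simp [BinaryQuartic.map]

/-- **`ℚ_p`-solubility from a unit square value modulo an odd prime**, for integral forms: if
`w² = f(x, 1)` in `ZMod p` with `w ≠ 0`, then `f` is `ℚ_p`-soluble. [folklore] -/
private theorem isSoluble_padic_of_zmod_sq {p : ℕ} [Fact p.Prime] (hp : p ≠ 2)
    (f : BinaryQuartic ℤ) {x w : ZMod p} (hw : w ≠ 0)
    (h : w ^ 2 = (f.map (Int.castRingHom (ZMod p))).eval x 1) :
    (f.map (Int.castRingHom ℚ_[p])).IsSoluble := by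
  rw [← map_intCast_map_coe]
  refine isSoluble_coe_of_smooth_zmod_point hp (f.map (Int.castRingHom ℤ_[p])) (t := x) (z := w)
    ?_ (Or.inl hw)
  rw [map_map_intCast]
  exact h

/-- The same through the other chart: `w² = f(1, x)` in `ZMod p` with `w ≠ 0`. [folklore] -/
private theorem isSoluble_padic_of_zmod_sq' {p : ℕ} [Fact p.Prime] (hp : p ≠ 2)
    (f : BinaryQuartic ℤ) {x w : ZMod p} (hw : w ≠ 0)
    (h : w ^ 2 = (f.map (Int.castRingHom (ZMod p))).eval 1 x) :
    (f.map (Int.castRingHom ℚ_[p])).IsSoluble := by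
  -- pass to the reversed form `f(y, x)`
  have hrev : ((⟨f.e, f.d, f.c, f.b, f.a⟩ : BinaryQuartic ℤ).map
      (Int.castRingHom ℚ_[p])).IsSoluble := by
    refine isSoluble_padic_of_zmod_sq hp _ (x := x) (w := w) hw ?_
    rw [h]
    simp only [BinaryQuartic.eval, BinaryQuartic.map]
    ring
  obtain ⟨u, v, z, huv, hz⟩ := hrev
  refine ⟨v, u, z, huv.symm, ?_⟩
  rw [hz]
  simp only [BinaryQuartic.eval, BinaryQuartic.map]
  ring

/-- In `ZMod p`, `p ∣ t² + 1` reads `(t : ZMod p)² = −1`. [folklore] -/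
private theorem zmod_sq_eq_neg_one_of_dvd {p t : ℕ} (hdvd : p ∣ t ^ 2 + 1) :
    ((t : ZMod p)) ^ 2 = -1 := by
  have h0 : ((t ^ 2 + 1 : ℕ) : ZMod p) = 0 := (ZMod.natCast_eq_zero_iff _ _).mpr hdvd
  push_cast at h0
  linear_combination h0

/-! ## The quartic `⟨d, 0, 2t, 0, e⟩` modulo `p` -/

/-- The value of the reduced form: `q(u, z) = d u⁴ + 2t u²z² + e z⁴` in any ring. [folklore] -/
private theorem eval_map_pencilQuartic {R : Type*} [CommRing R] (t : ℕ) (d e : ℤ) (u z : R) :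
    ((twoIsogenyQuartic (2 * (t : ℤ)) d e).map (Int.castRingHom R)).eval u z =
      (d : R) * u ^ 4 + 2 * (t : R) * u ^ 2 * z ^ 2 + (e : R) * z ^ 4 := by
  rw [eval_map_twoIsogenyQuartic]
  simp only [eq_intCast, Int.cast_mul, Int.cast_ofNat, Int.cast_natCast]

/-- `d e = t² + 1` read in any ring. [folklore] -/
private theorem cast_mul_eq_of_mul_eq {R : Type*} [CommRing R] {t : ℕ} {d e : ℤ}
    (he : d * e = (t : ℤ) ^ 2 + 1) : (d : R) * (e : R) = (t : R) ^ 2 + 1 := by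
  have := congrArg (Int.cast : ℤ → R) he
  push_cast at this
  exact this

/-! ## `p = 3` -/

/-- The finite fact behind `p = 3`: whenever `d e = t² + 1` in `𝔽₃`, one of `d x⁴ + 2t x² + e`,
`d + 2t x² + e x⁴` takes a non-zero square value. [folklore] -/
private theorem zmod_three_unit_square_value :
    ∀ d t e : ZMod 3, d * e = t ^ 2 + 1 →
      (∃ x w : ZMod 3, w ≠ 0 ∧ w ^ 2 = d * x ^ 4 + 2 * t * x ^ 2 + e) ∨
        (∃ x w : ZMod 3, w ≠ 0 ∧ w ^ 2 = d + 2 * t * x ^ 2 + e * x ^ 4) := by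
  decide

/-- `p = 3`: the curve `w² = d u⁴ + 2t u²z² + e z⁴` with `d e = t² + 1` has a `ℚ₃`-point (a unit
square value modulo `3`, lifted by Hensel's lemma). [folklore] -/
private theorem isSoluble_three {p : ℕ} [Fact p.Prime] (hp3 : p = 3) {t : ℕ} {d e : ℤ}
    (he : d * e = (t : ℤ) ^ 2 + 1) :
    ((twoIsogenyQuartic (2 * (t : ℤ)) d e).map (Int.castRingHom ℚ_[p])).IsSoluble := by
  subst hp3
  have hde : ((d : ZMod 3)) * (e : ZMod 3) = ((t : ZMod 3)) ^ 2 + 1 := cast_mul_eq_of_mul_eq he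
  rcases zmod_three_unit_square_value _ _ _ hde with ⟨x, w, hw, h⟩ | ⟨x, w, hw, h⟩
  · refine isSoluble_padic_of_zmod_sq (by norm_num) _ (x := x) hw ?_
    rw [eval_map_pencilQuartic, h]
    ring
  · refine isSoluble_padic_of_zmod_sq' (by norm_num) _ (x := x) hw ?_
    rw [eval_map_pencilQuartic, h]
    ring

/-! ## `p ∣ t² + 1` -/

/-- Over a field of characteristic `≠ 2`: if `c ≠ 0` and `ε ≠ −1` then `(c x)² + ε` takes the
non-zero square value `((ε + 1)/2)²` at `x = (ε − 1)/(2c)`. [folklore] -/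
private theorem exists_unit_sq_eq_sq_add {F : Type*} [Field F] (h2 : (2 : F) ≠ 0) {c : F}
    (hc : c ≠ 0) {ε : F} (hε : ε + 1 ≠ 0) :
    ∃ x w : F, w ≠ 0 ∧ w ^ 2 = (c * x) ^ 2 + ε := by
  refine ⟨(ε - 1) / (2 * c), (ε + 1) / 2, div_ne_zero hε h2, ?_⟩
  field_simp
  ring

/-- Over a field of characteristic `≠ 2` containing `τ` with `τ² = −1` and `τ + 1 ≠ 0`: for every
`ε`, `((τ + 1) x)² + ε` takes a non-zero square value (the previous lemma, or `x = 0`, `w = τ`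
when `ε = −1 = τ²`). [folklore] -/
private theorem exists_unit_sq_eq_sq_add' {F : Type*} [Field F] (h2 : (2 : F) ≠ 0) {τ : F}
    (hτ : τ ^ 2 = -1) (hτ1 : τ + 1 ≠ 0) (ε : F) :
    ∃ x w : F, w ≠ 0 ∧ w ^ 2 = ((τ + 1) * x) ^ 2 + ε := by
  by_cases hε : ε + 1 = 0
  · refine ⟨0, τ, ?_, ?_⟩
    · rintro rfl
      norm_num at hτ
    · rw [hτ]
      linear_combination -hε
  · exact exists_unit_sq_eq_sq_add h2 hτ1 hε

/-- `p ∣ t² + 1`, `p` odd: the curve `w² = d u⁴ + 2t u²z² + e z⁴` with `d e = t² + 1` has a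
`ℚ_p`-point. In `𝔽_p`, `τ² = −1`, `2τ = (τ + 1)²` and `d e = 0`; if `d ≡ 0` then
`q(x, 1) = ((τ+1)x)² + e`, if `e ≡ 0` then `q(1, s) = d + ((τ+1)s)²`, and either takes a unit
square value, which Hensel lifts. [folklore] -/
private theorem isSoluble_of_dvd {p : ℕ} [Fact p.Prime] (hp2 : p ≠ 2) {t : ℕ} {d e : ℤ}
    (he : d * e = (t : ℤ) ^ 2 + 1) (hpt : p ∣ t ^ 2 + 1) :
    ((twoIsogenyQuartic (2 * (t : ℤ)) d e).map (Int.castRingHom ℚ_[p])).IsSoluble := by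
  have hτ : ((t : ZMod p)) ^ 2 = -1 := zmod_sq_eq_neg_one_of_dvd hpt
  have h2 : (2 : ZMod p) ≠ 0 := by
    intro h
    have h' : ((2 : ℕ) : ZMod p) = 0 := by exact_mod_cast h
    rw [ZMod.natCast_eq_zero_iff] at h'
    exact hp2 ((Nat.prime_dvd_prime_iff_eq Fact.out Nat.prime_two).mp h')
  have hτ0 : (t : ZMod p) ≠ 0 := by
    intro h
    rw [h] at hτ
    norm_num at hτ
  have hτ1 : (t : ZMod p) + 1 ≠ 0 := by
    intro h
    have : ((t : ZMod p) + 1) ^ 2 = 2 * (t : ZMod p) := by linear_combination hτ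
    rw [h] at this
    rcases mul_eq_zero.mp (by simpa using this.symm : (2 : ZMod p) * (t : ZMod p) = 0) with h0 | h0
    · exact h2 h0
    · exact hτ0 h0
  have hde : ((d : ZMod p)) * (e : ZMod p) = 0 := by
    rw [cast_mul_eq_of_mul_eq he, hτ]
    ring
  rcases mul_eq_zero.mp hde with hd0 | he0
  · -- `d ≡ 0`: chart `(x, 1)`, `q(x, 1) = ((τ + 1) x)² + e`
    obtain ⟨x, w, hw, h⟩ := exists_unit_sq_eq_sq_add' h2 hτ hτ1 (e : ZMod p)
    refine isSoluble_padic_of_zmod_sq hp2 _ (x := x) hw ?_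
    rw [eval_map_pencilQuartic, hd0, h]
    linear_combination (x ^ 2) * hτ
  · -- `e ≡ 0`: chart `(1, s)`, `q(1, s) = d + ((τ + 1) s)²`
    obtain ⟨x, w, hw, h⟩ := exists_unit_sq_eq_sq_add' h2 hτ hτ1 (d : ZMod p)
    refine isSoluble_padic_of_zmod_sq' hp2 _ (x := x) hw ?_
    rw [eval_map_pencilQuartic, he0, h]
    linear_combination (x ^ 2) * hτ

/-! ## `p ∤ t² + 1`, `p ≥ 5` -/

/-- `p ∤ t² + 1`, `p ≥ 5`: the discriminant `256 (t² + 1)` is a `p`-adic unit, so good reduction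
gives a `ℚ_p`-point. [folklore] -/
private theorem isSoluble_of_not_dvd {p : ℕ} [Fact p.Prime] (hp5 : 5 ≤ p) {t : ℕ} {d e : ℤ}
    (he : d * e = (t : ℤ) ^ 2 + 1) (hpt : ¬ p ∣ t ^ 2 + 1) :
    ((twoIsogenyQuartic (2 * (t : ℤ)) d e).map (Int.castRingHom ℚ_[p])).IsSoluble := by
  apply isSoluble_padic_of_not_dvd_disc hp5
  have hdisc : (twoIsogenyQuartic (2 * (t : ℤ)) d e).disc = 2 ^ 8 * ((t : ℤ) ^ 2 + 1) := by
    rw [disc_twoIsogenyQuartic]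
    have : 16 * d * e * ((2 * (t : ℤ)) ^ 2 - 4 * d * e) ^ 2 =
        16 * (d * e) * ((2 * (t : ℤ)) ^ 2 - 4 * (d * e)) ^ 2 := by ring
    rw [this, he]
    ring
  rw [hdisc]
  intro hdiv
  have hpz : Prime (p : ℤ) := Nat.prime_iff_prime_int.mp Fact.out
  rcases hpz.dvd_or_dvd hdiv with h256 | ht2
  · have h2 : (p : ℤ) ∣ 2 := hpz.dvd_of_dvd_pow h256
    have h2' : p ∣ 2 := by exact_mod_cast h2
    have := (Nat.prime_dvd_prime_iff_eq Fact.out Nat.prime_two).mp h2'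
    omega
  · exact hpt (by exact_mod_cast ht2)

/-! ## The stub -/

/-- **Odd places impose no condition on the descent on the divisors of `b = t² + 1`.** For
`t ≥ 1`, every squarefree `d > 0` dividing `t² + 1` and every odd prime `p`, the homogeneous space
`w² = d u⁴ + 2t u²z² + ((t² + 1)/d) z⁴` of the `2`-isogeny of
`E_t : y² = x³ + 2t x² + (t² + 1) x` with kernel `(0, 0)` has a `ℚ_p`-point (good reduction for
`p ∤ t² + 1`, `p ≥ 5`; a unit square value modulo `3` for `p = 3`; an explicit smooth point
modulo `p` from `τ² = −1`, `2τ = (τ + 1)²` for `p ∣ t² + 1`; Hensel). [folklore] -/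
theorem stub_bSideOddPlaces :
    ∀ t : ℕ, 1 ≤ t → ∀ d : ℤ, 0 < d → Squarefree d → d ∣ (t : ℤ) ^ 2 + 1 →
      ∀ (p : ℕ) [Fact p.Prime], p ≠ 2 →
        ((twoIsogenyQuartic (2 * (t : ℤ)) d (((t : ℤ) ^ 2 + 1) / d)).map
          (Int.castRingHom ℚ_[p])).IsSoluble := by
  intro t _ d _ _ hdvd p _ hp2
  have he : d * (((t : ℤ) ^ 2 + 1) / d) = (t : ℤ) ^ 2 + 1 := Int.mul_ediv_cancel' hdvd
  by_cases hpt : p ∣ t ^ 2 + 1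
  · exact isSoluble_of_dvd hp2 he hpt
  by_cases hp3 : p = 3
  · exact isSoluble_three hp3 he
  have hp : p.Prime := Fact.out
  have hp4 : p ≠ 4 := by
    rintro rfl
    exact absurd hp (by decide)
  have hp5 : 5 ≤ p := by
    have := hp.two_le
    omega
  exact isSoluble_of_not_dvd hp5 he hpt

end Summit.Parity.BatemanHorn.Theorems.PencilSelmerDictionary

end
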